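import Mathlib
import HarnessLib
import Literature.NumberTheory.LFunctions.ZetaScrew
import Summits.RiemannHypothesis.RiemannHypothesis.Theorems.IntegerScrewIncrementSharp

/-!
# Route `IntegerScrew` — the LAG-`k` INCREMENT COVARIANCES of Kreĭn's screw line:
# `M·Cov(I_M, I_{M−k}) → −½·Δ²[k log k]` (PIVOT-LAW §2a(iv)–(v), DERIVED → THEOREM; RH-FREE)

For the screw line `x_t` of `Ψ = zetaScrew` (`‖x_t − x_s‖² = 2Ψ(t − s)`) and the increments over the
log-integer cells `I_m = x_{log m} − x_{log(m−1)}`, the covariance at lag `k ≥ 1` behind the corner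
`M` is the mixed second difference of `Ψ` over the lag cell (PIVOT-LAW §2a(iv)):
`Cov(I_M, I_{M−k}) = Ψ(log(M/(M−k−1))) + Ψ(log((M−1)/(M−k))) − Ψ(log(M/(M−k))) − Ψ(log((M−1)/(M−k−1)))`.
From the leading model of `Ψ` on the wall (`IntegerScrewIncrementSharp.abs_zetaScrew_sub_leadingModel_le`:
`|Ψ(t) − Λ(t)| ≤ 4t²`, `2Λ(t) = t log(1/t) − c₀t`) we prove, for every fixed `k ≥ 1`,

* `tendsto_incrementCovLag` : `M·Cov(I_M, I_{M−k}) → −½·((k+1)log(k+1) − 2k log k + (k−1)log(k−1))`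
  (at `k = 1` this is `IntegerScrewIncrementCovariance.tendsto_incrementCov`, value `−log 2` — not
  restated here; `≈ −1/(2k)` for large `k`);
* `tendsto_incrementEnergy_shift_div_log` : `M·2Ψ(log((M−j)/(M−j−1)))/log M → 1` for every fixed `j`
  (every increment variance near the corner is `(log M)/M` to leading order).

The mechanism is an exact scaling identity: the four lags have `u + v = a + b`, so the linear part
of `Λ` cancels and `M·(Λ(u)+Λ(v)−Λ(a)−Λ(b)) = −½(F(Mu)+F(Mv)−F(Ma)−F(Mb))`, `F(y) = y log y`, while
`Mu → k+1`, `Mv → k−1`, `Ma, Mb → k`.  CONSEQUENCE (PIVOT-LAW §2a(v), DERIVED there): the `K`-node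
predictors give `G(M)·log M ≥ Σ_{k ≤ K} (Δ²[k log k])²/4 − o(1)`, and `Σ_{k ≥ 1} (Δ²[k log k])²/4 =
0.6493589…` is exactly the Szegő continuum constant `V/2` of PIVOT-LAW §8.14–8.16.  A statement about
the explicit function `Ψ` on `[0, log 2)`; nothing here bears on the truth of RH. [Suzuki2023, (1.1)]
-/

noncomputable section

-- D-0017: `Summit.<S>.<S>.…` is the designed namespace of a single-problem summit.
set_option linter.dupNamespace false

namespace Summit.RiemannHypothesis.RiemannHypothesis.Theorems.IntegerScrew

open Literature.NumberTheory.LFunctions Filter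
open scoped Topology

/-! ### Elementary limits `M·log(M/(M−j)) → j` -/

/-- Eventually (in `M : ℕ`) the real cast exceeds any given real. [folklore] -/
private theorem eventually_natCast_gt (c : ℝ) : ∀ᶠ M : ℕ in atTop, c < (M : ℝ) :=
  tendsto_natCast_atTop_atTop.eventually (eventually_gt_atTop c)

/-- **`M · log(M/(M − j)) → j`** for every real `j`. [folklore] -/
theorem tendsto_mul_log_div_sub (j : ℝ) :
    Tendsto (fun M : ℕ => (M : ℝ) * Real.log ((M : ℝ) / ((M : ℝ) - j))) atTop (𝓝 j) := by
  have h := ((Real.tendsto_mul_log_one_add_div_atTop (-j)).comp tendsto_natCast_atTop_atTop).neg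
  rw [neg_neg] at h
  refine h.congr' ?_
  filter_upwards [eventually_natCast_gt (max j 0)] with M hM
  have hM0 : (0 : ℝ) < M := lt_of_le_of_lt (le_max_right _ _) hM
  have hMj : (0 : ℝ) < (M : ℝ) - j := by linarith [le_max_left j 0]
  have e : (1 : ℝ) + -j / (M : ℝ) = ((M : ℝ) - j) / (M : ℝ) := by field_simp; ring
  simp only [Function.comp_apply]
  rw [e, Real.log_div hMj.ne' hM0.ne', Real.log_div hM0.ne' hMj.ne']
  ring

/-- **`M · log((M − 1)/(M − j)) → j − 1`** for every real `j`. [folklore] -/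
theorem tendsto_mul_log_sub_one_div_sub (j : ℝ) :
    Tendsto (fun M : ℕ => (M : ℝ) * Real.log (((M : ℝ) - 1) / ((M : ℝ) - j))) atTop
      (𝓝 (j - 1)) := by
  have h := (tendsto_mul_log_div_sub j).sub (tendsto_mul_log_div_sub 1)
  refine h.congr' ?_
  filter_upwards [eventually_natCast_gt (max j 1)] with M hM
  have hM1 : (0 : ℝ) < (M : ℝ) - 1 := by linarith [le_max_right j 1]
  have hM0 : (0 : ℝ) < M := by linarith
  have hMj : (0 : ℝ) < (M : ℝ) - j := by linarith [le_max_left j 1]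
  rw [Real.log_div hM0.ne' hMj.ne', Real.log_div hM0.ne' hM1.ne', Real.log_div hM1.ne' hMj.ne']
  ring

/-! ### The leading model and the exact scaling identity -/

/-- The leading model extended to `t = 0`: `|Ψ(t) − Λ(t)| ≤ 4t²` for `0 ≤ t ≤ ½`
(`Ψ(0) = Λ(0) = 0`). [folklore] -/
private theorem abs_zetaScrew_sub_leadingModel_le' {t : ℝ} (ht0 : 0 ≤ t) (ht : t ≤ 1 / 2) :
    |zetaScrew t - (-(t * Real.log t)
      - (Real.log (2 * Real.pi) + Real.eulerMascheroniConstant - 1) * t) / 2| ≤ 4 * t ^ 2 := by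
  rcases ht0.eq_or_lt with h | h
  · subst h; simp [zetaScrew_zero]
  · exact abs_zetaScrew_sub_leadingModel_le h ht

/-- `F(Mx) = M·(x log x) + (Mx)·log M` for `M > 0` and every real `x` (`F(y) = y log y`; at `x = 0`
both sides vanish). [folklore] -/
private theorem mul_mul_log_mul {M : ℝ} (hM : 0 < M) (x : ℝ) :
    M * x * Real.log (M * x) = M * (x * Real.log x) + M * x * Real.log M := by
  rcases eq_or_ne x 0 with hx | hx
  · subst hx; simp
  · rw [Real.log_mul hM.ne' hx]; ring

/-- **Exact scaling identity.** If `u + v = a + b` then, with `Λ(t) = (−t log t − c₀t)/2` and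
`F(y) = y log y`, `M·(Λ(u)+Λ(v)−Λ(a)−Λ(b)) = −½·(F(Mu)+F(Mv)−F(Ma)−F(Mb))` for `M > 0`
(the `c₀`-terms and the `log M`-terms cancel). [folklore] -/
private theorem mul_model_mixed_eq {M u v a b : ℝ} (hM : 0 < M) (h : u + v = a + b) (c : ℝ) :
    M * ((-(u * Real.log u) - c * u) / 2 + (-(v * Real.log v) - c * v) / 2
      - (-(a * Real.log a) - c * a) / 2 - (-(b * Real.log b) - c * b) / 2)
    = -(M * u * Real.log (M * u) + M * v * Real.log (M * v)
        - M * a * Real.log (M * a) - M * b * Real.log (M * b)) / 2 := by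
  rw [mul_mul_log_mul hM u, mul_mul_log_mul hM v, mul_mul_log_mul hM a, mul_mul_log_mul hM b]
  have hv : v = a + b - u := by linarith
  subst hv
  ring

/-! ### The lag-`k` covariance limit -/

/-- `0 ≤ log(p/q) ≤ (p − q)/q` for `0 < q ≤ p`. [folklore] -/
private theorem log_div_nonneg_le {p q : ℝ} (hq : 0 < q) (hqp : q ≤ p) :
    0 ≤ Real.log (p / q) ∧ Real.log (p / q) ≤ (p - q) / q := by
  have hx : 1 ≤ p / q := by rwa [le_div_iff₀ hq, one_mul]
  refine ⟨Real.log_nonneg hx, ?_⟩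
  have h := Real.log_le_sub_one_of_pos (lt_of_lt_of_le one_pos hx)
  have : p / q - 1 = (p - q) / q := by field_simp
  linarith

/-- **THE LAG-`k` INCREMENT COVARIANCE.** For every `k ≥ 1`,
`M·(Ψ(log(M/(M−k−1))) + Ψ(log((M−1)/(M−k))) − Ψ(log(M/(M−k))) − Ψ(log((M−1)/(M−k−1))))
 → −½·((k+1)·log(k+1) − 2·k·log k + (k−1)·log(k−1))` as `M → ∞` — i.e.
`M·Cov(I_M, I_{M−k}) → −½Δ²[k log k]` (`= −log 2` at `k = 1`; `∼ −1/(2k)`). [folklore] -/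
theorem tendsto_incrementCovLag (k : ℕ) (hk : 1 ≤ k) :
    Tendsto (fun M : ℕ => (M : ℝ) *
        (zetaScrew (Real.log ((M : ℝ) / ((M : ℝ) - (k + 1))))
          + zetaScrew (Real.log (((M : ℝ) - 1) / ((M : ℝ) - k)))
          - zetaScrew (Real.log ((M : ℝ) / ((M : ℝ) - k)))
          - zetaScrew (Real.log (((M : ℝ) - 1) / ((M : ℝ) - (k + 1))))))
      atTop
      (𝓝 (-(((k : ℝ) + 1) * Real.log ((k : ℝ) + 1) - 2 * ((k : ℝ) * Real.log k)
        + ((k : ℝ) - 1) * Real.log ((k : ℝ) - 1)) / 2)) := by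
  have hk' : (1 : ℝ) ≤ k := by exact_mod_cast hk
  set c₀ : ℝ := Real.log (2 * Real.pi) + Real.eulerMascheroniConstant - 1 with hc0
  -- the model Λ and the function F(y) = y log y
  set Λ : ℝ → ℝ := fun t => (-(t * Real.log t) - c₀ * t) / 2 with hΛ
  have hF : Continuous fun y : ℝ => y * Real.log y := Real.continuous_mul_log
  -- the four scaled lags and their limits
  have hu := tendsto_mul_log_div_sub ((k : ℝ) + 1)          -- M·u → k+1
  have hv := tendsto_mul_log_sub_one_div_sub (k : ℝ)          -- M·v → k−1
  have ha := tendsto_mul_log_div_sub (k : ℝ)                  -- M·a → k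
  have hb := tendsto_mul_log_sub_one_div_sub ((k : ℝ) + 1)    -- M·b → k
  have hb' : Tendsto (fun M : ℕ => (M : ℝ) * Real.log (((M : ℝ) - 1) / ((M : ℝ) - ((k : ℝ) + 1))))
      atTop (𝓝 (k : ℝ)) := by
    have e : (k : ℝ) + 1 - 1 = k := by ring
    rw [e] at hb; exact hb
  -- the main term: −½(F(Mu)+F(Mv)−F(Ma)−F(Mb)) → the limit
  have hmain : Tendsto (fun M : ℕ =>
      -(((M : ℝ) * Real.log ((M : ℝ) / ((M : ℝ) - (k + 1))))
            * Real.log ((M : ℝ) * Real.log ((M : ℝ) / ((M : ℝ) - (k + 1))))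
        + ((M : ℝ) * Real.log (((M : ℝ) - 1) / ((M : ℝ) - k)))
            * Real.log ((M : ℝ) * Real.log (((M : ℝ) - 1) / ((M : ℝ) - k)))
        - ((M : ℝ) * Real.log ((M : ℝ) / ((M : ℝ) - k)))
            * Real.log ((M : ℝ) * Real.log ((M : ℝ) / ((M : ℝ) - k)))
        - ((M : ℝ) * Real.log (((M : ℝ) - 1) / ((M : ℝ) - (k + 1))))
            * Real.log ((M : ℝ) * Real.log (((M : ℝ) - 1) / ((M : ℝ) - (k + 1))))) / 2)
      atTop
      (𝓝 (-(((k : ℝ) + 1) * Real.log ((k : ℝ) + 1) + ((k : ℝ) - 1) * Real.log ((k : ℝ) - 1)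
        - (k : ℝ) * Real.log k - (k : ℝ) * Real.log k) / 2)) := by
    have := (((hF.tendsto _).comp hu).add ((hF.tendsto _).comp hv)).sub ((hF.tendsto _).comp ha)
    have := (this.sub ((hF.tendsto _).comp hb')).neg.div_const 2
    exact this
  have elim : -(((k : ℝ) + 1) * Real.log ((k : ℝ) + 1) + ((k : ℝ) - 1) * Real.log ((k : ℝ) - 1)
        - (k : ℝ) * Real.log k - (k : ℝ) * Real.log k) / 2
      = -(((k : ℝ) + 1) * Real.log ((k : ℝ) + 1) - 2 * ((k : ℝ) * Real.log k)
        + ((k : ℝ) - 1) * Real.log ((k : ℝ) - 1)) / 2 := by ring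
  rw [elim] at hmain
  -- the error term: M·Σ|Ψ − Λ| ≤ 64(k+1)²/M → 0
  have herr : Tendsto (fun M : ℕ => 64 * ((k : ℝ) + 1) ^ 2 / (M : ℝ)) atTop (𝓝 0) :=
    tendsto_const_nhds.div_atTop tendsto_natCast_atTop_atTop
  -- names for the target and the main term
  set f : ℕ → ℝ := fun M => (M : ℝ) *
        (zetaScrew (Real.log ((M : ℝ) / ((M : ℝ) - (k + 1))))
          + zetaScrew (Real.log (((M : ℝ) - 1) / ((M : ℝ) - k)))
          - zetaScrew (Real.log ((M : ℝ) / ((M : ℝ) - k)))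
          - zetaScrew (Real.log (((M : ℝ) - 1) / ((M : ℝ) - (k + 1))))) with hf
  set g : ℕ → ℝ := fun M =>
      -(((M : ℝ) * Real.log ((M : ℝ) / ((M : ℝ) - (k + 1))))
            * Real.log ((M : ℝ) * Real.log ((M : ℝ) / ((M : ℝ) - (k + 1))))
        + ((M : ℝ) * Real.log (((M : ℝ) - 1) / ((M : ℝ) - k)))
            * Real.log ((M : ℝ) * Real.log (((M : ℝ) - 1) / ((M : ℝ) - k)))
        - ((M : ℝ) * Real.log ((M : ℝ) / ((M : ℝ) - k)))
            * Real.log ((M : ℝ) * Real.log ((M : ℝ) / ((M : ℝ) - k)))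
        - ((M : ℝ) * Real.log (((M : ℝ) - 1) / ((M : ℝ) - (k + 1))))
            * Real.log ((M : ℝ) * Real.log (((M : ℝ) - 1) / ((M : ℝ) - (k + 1))))) / 2 with hg
  -- the bound |f M − g M| ≤ 64(k+1)²/M for M ≥ 4(k+1)
  have hbound : ∀ᶠ M : ℕ in atTop, ‖f M - g M‖ ≤ 64 * ((k : ℝ) + 1) ^ 2 / (M : ℝ) := by
    filter_upwards [eventually_ge_atTop (4 * (k + 1))] with M hM
    have hm : (4 : ℝ) * ((k : ℝ) + 1) ≤ (M : ℝ) := by exact_mod_cast hM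
    set m : ℝ := (M : ℝ) with hmdef
    have hm0 : 0 < m := by linarith
    have hq : 0 < m - ((k : ℝ) + 1) := by linarith
    have hqk : 0 < m - (k : ℝ) := by linarith
    have hq1 : 0 < m - 1 := by linarith
    -- the four lags
    set u : ℝ := Real.log (m / (m - ((k : ℝ) + 1))) with hu_def
    set v : ℝ := Real.log ((m - 1) / (m - (k : ℝ))) with hv_def
    set a : ℝ := Real.log (m / (m - (k : ℝ))) with ha_def
    set b : ℝ := Real.log ((m - 1) / (m - ((k : ℝ) + 1))) with hb_def
    -- u + v = a + b
    have hsum : u + v = a + b := by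
      rw [hu_def, hv_def, ha_def, hb_def, Real.log_div hm0.ne' hq.ne', Real.log_div hq1.ne' hqk.ne',
        Real.log_div hm0.ne' hqk.ne', Real.log_div hq1.ne' hq.ne']
      ring
    -- common bound B = (k+1)/(m−k−1) ≤ 1/2 and ≤ 2(k+1)/m
    set B : ℝ := ((k : ℝ) + 1) / (m - ((k : ℝ) + 1)) with hB
    have hB_half : B ≤ 1 / 2 := by
      rw [hB, div_le_iff₀ hq]; linarith
    have hB_le : B ≤ 2 * ((k : ℝ) + 1) / m := by
      rw [hB, div_le_div_iff₀ hq hm0]; nlinarith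
    have hB0 : 0 ≤ B := by rw [hB]; positivity
    -- each lag lies in [0, B]
    have hu01 : 0 ≤ u ∧ u ≤ B := by
      obtain ⟨h0, h1⟩ := log_div_nonneg_le hq (by linarith : m - ((k : ℝ) + 1) ≤ m)
      refine ⟨h0, h1.trans (le_of_eq ?_)⟩
      rw [hB]; ring
    have hv01 : 0 ≤ v ∧ v ≤ B := by
      obtain ⟨h0, h1⟩ := log_div_nonneg_le hqk (by linarith : m - (k : ℝ) ≤ m - 1)
      refine ⟨h0, h1.trans ?_⟩
      rw [hB, div_le_div_iff₀ hqk hq]; nlinarith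
    have ha01 : 0 ≤ a ∧ a ≤ B := by
      obtain ⟨h0, h1⟩ := log_div_nonneg_le hqk (by linarith : m - (k : ℝ) ≤ m)
      refine ⟨h0, h1.trans ?_⟩
      rw [hB, div_le_div_iff₀ hqk hq]; nlinarith
    have hb01 : 0 ≤ b ∧ b ≤ B := by
      obtain ⟨h0, h1⟩ := log_div_nonneg_le hq (by linarith : m - ((k : ℝ) + 1) ≤ m - 1)
      refine ⟨h0, h1.trans ?_⟩
      rw [hB]
      exact div_le_div_of_nonneg_right (by linarith) hq.le
    -- the model error at each lag: ≤ 4x² ≤ 4B² ≤ 16(k+1)²/m²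
    have hB2 : 4 * B ^ 2 ≤ 16 * ((k : ℝ) + 1) ^ 2 / m ^ 2 := by
      have h2 : B ^ 2 ≤ (2 * ((k : ℝ) + 1) / m) ^ 2 := pow_le_pow_left₀ hB0 hB_le 2
      calc 4 * B ^ 2 ≤ 4 * (2 * ((k : ℝ) + 1) / m) ^ 2 := mul_le_mul_of_nonneg_left h2 (by norm_num)
        _ = 16 * ((k : ℝ) + 1) ^ 2 / m ^ 2 := by rw [div_pow]; ring
    have hE : ∀ x : ℝ, 0 ≤ x ∧ x ≤ B → |zetaScrew x - Λ x| ≤ 16 * ((k : ℝ) + 1) ^ 2 / m ^ 2 := by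
      rintro x ⟨hx0, hxB⟩
      have h := abs_zetaScrew_sub_leadingModel_le' hx0 (hxB.trans hB_half)
      have hx2 : 4 * x ^ 2 ≤ 4 * B ^ 2 := by
        have := pow_le_pow_left₀ hx0 hxB 2; linarith
      exact h.trans (hx2.trans hB2)
    -- f M − g M = m·Σ±(Ψ − Λ)
    have hmodel := mul_model_mixed_eq hm0 hsum c₀
    have hdiff : f M - g M = m * ((zetaScrew u - Λ u) + (zetaScrew v - Λ v)
        - (zetaScrew a - Λ a) - (zetaScrew b - Λ b)) := by
      have e1 : f M = m * (zetaScrew u + zetaScrew v - zetaScrew a - zetaScrew b) := by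
        simp only [hf, hu_def, hv_def, ha_def, hb_def, hmdef]
      have e2 : g M = m * (Λ u + Λ v - Λ a - Λ b) := by
        -- `rw` matches `m * (Λ u + …)` up to unfolding the local definitions and closes by `rfl`
        rw [hmodel]
      rw [e1, e2]; ring
    rw [Real.norm_eq_abs, hdiff, abs_mul, abs_of_pos hm0]
    have h4 : |(zetaScrew u - Λ u) + (zetaScrew v - Λ v) - (zetaScrew a - Λ a) - (zetaScrew b - Λ b)|
        ≤ 4 * (16 * ((k : ℝ) + 1) ^ 2 / m ^ 2) := by
      have h1 := hE u hu01; have h2 := hE v hv01; have h3 := hE a ha01; have h4 := hE b hb01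
      calc |(zetaScrew u - Λ u) + (zetaScrew v - Λ v) - (zetaScrew a - Λ a) - (zetaScrew b - Λ b)|
          ≤ |(zetaScrew u - Λ u) + (zetaScrew v - Λ v) - (zetaScrew a - Λ a)| + |zetaScrew b - Λ b| :=
            abs_sub _ _
        _ ≤ (|(zetaScrew u - Λ u) + (zetaScrew v - Λ v)| + |zetaScrew a - Λ a|) + |zetaScrew b - Λ b| := by
            gcongr; exact abs_sub _ _
        _ ≤ ((|zetaScrew u - Λ u| + |zetaScrew v - Λ v|) + |zetaScrew a - Λ a|) + |zetaScrew b - Λ b| := by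
            gcongr; exact abs_add_le _ _
        _ ≤ 4 * (16 * ((k : ℝ) + 1) ^ 2 / m ^ 2) := by linarith
    calc m * |(zetaScrew u - Λ u) + (zetaScrew v - Λ v) - (zetaScrew a - Λ a) - (zetaScrew b - Λ b)|
        ≤ m * (4 * (16 * ((k : ℝ) + 1) ^ 2 / m ^ 2)) := mul_le_mul_of_nonneg_left h4 hm0.le
      _ = 64 * ((k : ℝ) + 1) ^ 2 / m := by field_simp; ring
  have hsmall : Tendsto (fun M : ℕ => f M - g M) atTop (𝓝 0) := squeeze_zero_norm' hbound herr
  have htot := hmain.add hsmall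
  rw [add_zero] at htot
  refine htot.congr fun M => ?_
  show g M + (f M - g M) = f M
  ring

/-! ### Every increment variance near the corner is `(log M)/M` to leading order -/

/-- `log(M − j)/log M → 1` for every real `j`. [folklore] -/
private theorem tendsto_log_sub_div_log (j : ℝ) :
    Tendsto (fun M : ℕ => Real.log ((M : ℝ) - j) / Real.log (M : ℝ)) atTop (𝓝 1) := by
  have hlog : Tendsto (fun M : ℕ => Real.log (M : ℝ)) atTop atTop :=
    Real.tendsto_log_atTop.comp tendsto_natCast_atTop_atTop
  -- log(M−j) − log M = −log(M/(M−j)) → 0 (it is O(1/M))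
  have h0 : Tendsto (fun M : ℕ => Real.log ((M : ℝ) / ((M : ℝ) - j))) atTop (𝓝 0) := by
    have h := (tendsto_mul_log_div_sub j)
    -- (M·log(M/(M−j))) · (1/M) → j · 0
    have h' := h.mul (tendsto_const_nhds.div_atTop tendsto_natCast_atTop_atTop :
      Tendsto (fun M : ℕ => (1 : ℝ) / (M : ℝ)) atTop (𝓝 0))
    rw [mul_zero] at h'
    refine h'.congr' ?_
    filter_upwards [eventually_natCast_gt 0] with M hM
    field_simp
  have h1 : Tendsto (fun M : ℕ => 1 - Real.log ((M : ℝ) / ((M : ℝ) - j)) / Real.log (M : ℝ)) atTop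
      (𝓝 (1 - 0)) := tendsto_const_nhds.sub (h0.div_atTop hlog)
  rw [sub_zero] at h1
  refine h1.congr' ?_
  filter_upwards [eventually_natCast_gt (max j 1)] with M hM
  have hM1 : (1 : ℝ) < M := lt_of_le_of_lt (le_max_right _ _) hM
  have hMj : (0 : ℝ) < (M : ℝ) - j := by linarith [le_max_left j 1]
  have hlogM : Real.log (M : ℝ) ≠ 0 := (Real.log_pos hM1).ne'
  rw [Real.log_div (by linarith) hMj.ne']
  field_simp
  ring

/-- **`M·2Ψ(log((M−j)/(M−j−1)))/log M → 1`** for every fixed `j : ℕ`: the variance of the increment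
`I_{M−j}`, scaled by `M`, is `log M·(1 + o(1))` (from `tendsto_incrementEnergy_sub_log` at the corner
`M − j`). [folklore] -/
theorem tendsto_incrementEnergy_shift_div_log (j : ℕ) :
    Tendsto (fun M : ℕ => (M : ℝ) * (2 * zetaScrew (Real.log (((M : ℝ) - j) / ((M : ℝ) - j - 1))))
        / Real.log (M : ℝ)) atTop (𝓝 1) := by
  have hlog : Tendsto (fun M : ℕ => Real.log (M : ℝ)) atTop atTop :=
    Real.tendsto_log_atTop.comp tendsto_natCast_atTop_atTop
  -- at the shifted corner N = M − j:  N·2Ψ(h_N) − log N → −c₀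
  have hN := tendsto_incrementEnergy_sub_log.comp (tendsto_sub_atTop_nat j)
  -- hence (N·2Ψ(h_N) − log N)/log M → 0
  have hA : Tendsto (fun M : ℕ => (((M - j : ℕ) : ℝ) * (2 * zetaScrew (Real.log
      (((M - j : ℕ) : ℝ) / (((M - j : ℕ) : ℝ) - 1)))) - Real.log ((M - j : ℕ) : ℝ)) / Real.log (M : ℝ))
      atTop (𝓝 0) := hN.div_atTop hlog
  -- log N / log M → 1 and M/N → 1
  have hB : Tendsto (fun M : ℕ => Real.log ((M : ℝ) - j) / Real.log (M : ℝ)) atTop (𝓝 1) :=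
    tendsto_log_sub_div_log j
  have hC : Tendsto (fun M : ℕ => (M : ℝ) / ((M : ℝ) - j)) atTop (𝓝 1) := by
    -- M/(M−j) = 1 + j/(M−j)
    have h2 : Tendsto (fun M : ℕ => 1 + (j : ℝ) / ((M : ℝ) - j)) atTop (𝓝 (1 + 0)) := by
      refine tendsto_const_nhds.add (tendsto_const_nhds.div_atTop ?_)
      have := tendsto_atTop_add_const_right atTop (-(j : ℝ)) tendsto_natCast_atTop_atTop
      simpa [sub_eq_add_neg] using this
    rw [add_zero] at h2
    refine h2.congr' ?_
    filter_upwards [eventually_natCast_gt (j : ℝ)] with M hM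
    have hMj : (M : ℝ) - j ≠ 0 := by linarith
    field_simp
    ring
  -- combine: M·2Ψ/log M = (M/N)·(A + B)
  have htot := hC.mul (hA.add hB)
  rw [zero_add, mul_one] at htot
  refine htot.congr' ?_
  filter_upwards [eventually_ge_atTop (j + 2)] with M hM
  have hcast : ((M - j : ℕ) : ℝ) = (M : ℝ) - j := by
    rw [Nat.cast_sub (by omega)]
  have hM2 : (2 : ℝ) + j ≤ M := by exact_mod_cast (show j + 2 ≤ M by omega) |>.trans_eq' (by ring)
  have hMj : (M : ℝ) - j ≠ 0 := by linarith
  have hlogM : Real.log (M : ℝ) ≠ 0 := (Real.log_pos (by linarith : (1 : ℝ) < M)).ne'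
  rw [hcast]
  field_simp
  ring

end Summit.RiemannHypothesis.RiemannHypothesis.Theorems.IntegerScrew
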